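import Literature.AnabelianGeometry.EtaleTheta.SettingModelThetaFixedRigidityOfPBF
import Literature.AnabelianGeometry.EtaleTheta.SettingModelTorusStableOfPBF
import Literature.AnabelianGeometry.EtaleTheta.SettingModelTwistedTorusCoboundaryOfPBF
import Literature.AnabelianGeometry.EtaleTheta.SettingModelTorusNormalFormOnLines
import Literature.AnabelianGeometry.EtaleTheta.FreeProfinitePermBasisPrime
import HarnessLib

/-!
# (L3′) SLICE 1 ASSEMBLED: Prop R1b in line form for finite-index `V ≤ G_{ℚ_p}` from (PBF), and the six
# UNCONDITIONAL closers (the T-chain ∘ the P-chain)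

PROOF-ONLY.  Part 1 (`…_of_permBasisFixedPoints`): the three hypothesis slots `hStab` / `hCob` / `hFix` of
`SettingModelTorusNormalFormOnLines` filled BY NAME with Cor R1′ (`torusStable_of_permBasisFixedPoints`), Lemma R1b♯
(`twistedTorusCoboundary_of_permBasisFixedPoints`) and Theorem R1 (R1a) on `V`
(`thetaFixedRigidityOn_of_permBasisFixedPoints`), CONDITIONAL on the displayed tree-free hypothesis `PermBasisFixedPoints`.
Part 2 (`…_holds`): the same statements with `PermBasisFixedPoints` DISCHARGED by the P-chain's
`TreeFree.permBasisFixedPoints_holds` (`FreeProfinitePermBasisPrime`): `thetaFixedRigidity_holds`,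
`thetaFixedRigidityOn_holds`, `torusStable_holds`, `twistedTorusCoboundary_holds`, `exists_torusNormalForm_holds`,
`torusNormalForm_unique_holds` — no displayed `Prop` hypothesis remains.
Classical profinite group theory about OUR semi-synthetic `F₂hatT`; nothing about [EtTh]/[IUTchII]/[IUTchIII] in print
is asserted; CELL hextΔ/hΘ UNDECIDED-AT-MODEL; no side on [IUTchIII] Cor 3.12; nothing here asserts abc proved or refuted.
abc-iut-L6-t19 (T-chain, gen 22; assembly filed gen 24) ∘ abc-iut-w6-d081 (P-chain).
-/
noncomputable section
/-! ## Part 1 — SLICE 1 ASSEMBLED: Prop R1b in line form for `V ≤ G_{ℚ_p}` of finite index, from (PBF) ALONE -/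

namespace Literature.AnabelianGeometry.EtaleTheta.SettingModel.Slice1

open Literature.AnabelianGeometry.EtaleTheta.SettingModel
open Literature.AnabelianGeometry.SemiGraphs (GQp)
open Literature.AnabelianGeometry.AbsoluteAnabelian.AbsTopII
open Literature.AnabelianGeometry.EtaleTheta.SettingModel.BTorsionTower
open Literature.AnabelianGeometry.EtaleTheta.SettingModel.TreeFree (PermBasisFixedPoints permBasisFixedPoints_holds)
open Literature.AnabelianGeometry.EtaleTheta.SettingModel.TorusNormalForm

variable (p : ℕ) [Fact p.Prime] (V : Subgroup (GQp p)) [V.FiniteIndex]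

/-- **(L3′) SLICE 1, EXISTENCE, from (PBF) alone** (`V ≤ G_{ℚ_p}` of finite index): the torus-normal form of a
`b`-line map `Λ` intertwining `θ_V` with the `η`-twisted torus — Prop R1b (1)(2)(3) of PL3-R1A in line form — with
the tree-consuming hypotheses `hStab`/`hCob` DISCHARGED by Cor R1′ / Lemma R1b♯ from `PermBasisFixedPoints`.
[cite: MochizukiEtTh2009, §1 p.12] -/
theorem exists_torusNormalForm_of_permBasisFixedPoints (hPBF : PermBasisFixedPoints.{0})
    (η : GQp p → F₂hatT) (hη : ∀ u ∈ V, ∀ v ∈ V, η (u * v) = η u * twist (chi p u) (η v))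
    (Λ : F₂hatT → F₂hatT)
    (hΛB : ∀ x y : F₂hatT, x⁻¹ * y ∈ bAxis → (Λ x)⁻¹ * Λ y ∈ bAxis)
    (hΛinj : ∀ x y : F₂hatT, (Λ x)⁻¹ * Λ y ∈ bAxis → x⁻¹ * y ∈ bAxis)
    (hΛsurj : ∀ y : F₂hatT, ∃ x : F₂hatT, (Λ x)⁻¹ * y ∈ bAxis)
    (hΛθ : ∀ v ∈ V, ∀ x : F₂hatT, (Λ (twist (chi p v) x))⁻¹ * (η v * twist (chi p v) (Λ x)) ∈ bAxis) :
    ∃ f : F₂hatT,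
      (∀ v ∈ V, f⁻¹ * (η v * twist (chi p v) f) = 1) ∧
      (f⁻¹ * Λ 1 ∈ bAxis) ∧
      (∀ s : ZH, ∃ s' : ZH,
        (powHat (eta (FreeGroup.of 0)) s')⁻¹ * (f⁻¹ * Λ (powHat (eta (FreeGroup.of 0)) s)) ∈ bAxis) ∧
      (∀ s' : ZH, ∃ s : ZH,
        (powHat (eta (FreeGroup.of 0)) s')⁻¹ * (f⁻¹ * Λ (powHat (eta (FreeGroup.of 0)) s)) ∈ bAxis) :=
  exists_torusNormalForm p V
    (fun x hx => torusStable_of_permBasisFixedPoints p hPBF V x hx)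
    (fun η' hη' _ _ h₁ h₂ hne => twistedTorusCoboundary_of_permBasisFixedPoints p hPBF V η' hη' h₁ h₂ hne)
    η hη Λ hΛB hΛinj hΛsurj hΛθ

/-- **(L3′) SLICE 1, UNIQUENESS, from (PBF) alone** (`V` of finite index): the normalising element `f` is unique —
`hFix` DISCHARGED by Theorem R1 (R1a) on `V` from `PermBasisFixedPoints`. [cite: MochizukiEtTh2009, §1 p.12] -/
theorem torusNormalForm_unique_of_permBasisFixedPoints (hPBF : PermBasisFixedPoints.{0})
    (η : GQp p → F₂hatT) (Λ : F₂hatT → F₂hatT) {f₁ f₂ : F₂hatT}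
    (h₁ : ∀ v ∈ V, f₁⁻¹ * (η v * twist (chi p v) f₁) = 1) (h₁B : f₁⁻¹ * Λ 1 ∈ bAxis)
    (h₂ : ∀ v ∈ V, f₂⁻¹ * (η v * twist (chi p v) f₂) = 1) (h₂B : f₂⁻¹ * Λ 1 ∈ bAxis) :
    f₁ = f₂ :=
  torusNormalForm_unique p V
    (fun w hw => thetaFixedRigidityOn_of_permBasisFixedPoints p hPBF V w hw)
    η Λ h₁ h₁B h₂ h₂B

omit [V.FiniteIndex] in
/-- The consumer's shape: an OPEN `V ≤ G_{ℚ_p}` (e.g. the image of an open subgroup of `G_K`) has finite index, so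
the existence statement applies. [cite: MochizukiEtTh2009, §1 p.12] -/
theorem finiteIndex_of_isOpen (hV : IsOpen (V : Set (GQp p))) : V.FiniteIndex := by
  haveI : Finite (GQp p ⧸ V) := Subgroup.quotient_finite_of_isOpen V hV
  exact Subgroup.finiteIndex_of_finite_quotient

/-! ## Part 2 — (L3′) SLICE 1, UNCONDITIONAL: the T-chain ∘ the P-chain (`TreeFree.permBasisFixedPoints_holds`) -/

section Closers

omit [V.FiniteIndex]

/-- **THEOREM R1 (R1a) — `ThetaFixedRigidity p` — UNCONDITIONAL**: T-chain (abc-iut-L6-t19) ∘ P-chain (abc-iut-w6-d081,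
`permBasisFixedPoints_holds`).  Classical group theory about OUR semi-synthetic `F₂hatT`; cf. [EtTh] §1.
[cite: MochizukiEtTh2009, §1 p.12] -/
theorem thetaFixedRigidity_holds : ThetaFixedRigidity p :=
  thetaFixedRigidity_of_permBasisFixedPoints p permBasisFixedPoints_holds

/-- **THEOREM R1 (R1a) on a finite-index `U ≤ G_{ℚ_p}`, UNCONDITIONAL**: a `θ_U`-fixed element of `F̂₂` is a power
`a^s` of `a = η x₀`.  cf. [EtTh] §1. [cite: MochizukiEtTh2009, §1 p.12] -/
theorem thetaFixedRigidityOn_holds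
    (U : Subgroup (GQp p)) [U.FiniteIndex] (w : F₂hatT) (hw : ∀ σ ∈ U, twist (chi p σ) w = w) :
    ∃ s : ZH, w = powHat (eta (FreeGroup.of 0)) s :=
  thetaFixedRigidityOn_of_permBasisFixedPoints p permBasisFixedPoints_holds U w hw

/-- **COROLLARY R1′ (torus-stable `b`-lines are axis lines), UNCONDITIONAL.**  cf. [EtTh] §1.
[cite: MochizukiEtTh2009, §1 p.12] -/
theorem torusStable_holds
    (U : Subgroup (GQp p)) [U.FiniteIndex] (x : F₂hatT) (hx : ∀ σ ∈ U, x⁻¹ * twist (chi p σ) x ∈ bAxis) :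
    ∃ s t : ZH, x = powHat (eta (FreeGroup.of 0)) s * bPow t :=
  torusStable_of_permBasisFixedPoints p permBasisFixedPoints_holds U x hx

/-- **LEMMA R1b♯ (two stable lines ⇒ coboundary), UNCONDITIONAL.**  cf. [EtTh] §1. [cite: MochizukiEtTh2009, §1 p.12] -/
theorem twistedTorusCoboundary_holds
    (η : GQp p → F₂hatT)
    (hη : ∀ u ∈ V, ∀ v ∈ V, η (u * v) = η u * twist (chi p u) (η v)) {x₁ x₂ : F₂hatT}
    (hx₁ : ∀ v ∈ V, x₁⁻¹ * (η v * twist (chi p v) x₁) ∈ bAxis)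
    (hx₂ : ∀ v ∈ V, x₂⁻¹ * (η v * twist (chi p v) x₂) ∈ bAxis) (hne : x₁⁻¹ * x₂ ∉ bAxis) :
    ∃ y : F₂hatT, ∀ v ∈ V, η v = y * (twist (chi p v) y)⁻¹ :=
  twistedTorusCoboundary_of_permBasisFixedPoints p permBasisFixedPoints_holds V η hη hx₁ hx₂ hne

end Closers

/-- **(L3′) SLICE 1 — Prop R1b in line form (existence), UNCONDITIONAL**, every finite-index `V`.  cf. [EtTh] §1.
[cite: MochizukiEtTh2009, §1 p.12] -/
theorem exists_torusNormalForm_holds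
    (η : GQp p → F₂hatT) (hη : ∀ u ∈ V, ∀ v ∈ V, η (u * v) = η u * twist (chi p u) (η v))
    (Λ : F₂hatT → F₂hatT)
    (hΛB : ∀ x y : F₂hatT, x⁻¹ * y ∈ bAxis → (Λ x)⁻¹ * Λ y ∈ bAxis)
    (hΛinj : ∀ x y : F₂hatT, (Λ x)⁻¹ * Λ y ∈ bAxis → x⁻¹ * y ∈ bAxis)
    (hΛsurj : ∀ y : F₂hatT, ∃ x : F₂hatT, (Λ x)⁻¹ * y ∈ bAxis)
    (hΛθ : ∀ v ∈ V, ∀ x : F₂hatT, (Λ (twist (chi p v) x))⁻¹ * (η v * twist (chi p v) (Λ x)) ∈ bAxis) :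
    ∃ f : F₂hatT,
      (∀ v ∈ V, f⁻¹ * (η v * twist (chi p v) f) = 1) ∧
      (f⁻¹ * Λ 1 ∈ bAxis) ∧
      (∀ s : ZH, ∃ s' : ZH,
        (powHat (eta (FreeGroup.of 0)) s')⁻¹ * (f⁻¹ * Λ (powHat (eta (FreeGroup.of 0)) s)) ∈ bAxis) ∧
      (∀ s' : ZH, ∃ s : ZH,
        (powHat (eta (FreeGroup.of 0)) s')⁻¹ * (f⁻¹ * Λ (powHat (eta (FreeGroup.of 0)) s)) ∈ bAxis) :=
  exists_torusNormalForm_of_permBasisFixedPoints p V permBasisFixedPoints_holds η hη Λ hΛB hΛinj hΛsurj hΛθ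

/-- **(L3′) SLICE 1 — Prop R1b in line form (uniqueness), UNCONDITIONAL.**  cf. [EtTh] §1. [cite: MochizukiEtTh2009, §1 p.12] -/
theorem torusNormalForm_unique_holds
    (η : GQp p → F₂hatT) (Λ : F₂hatT → F₂hatT) {f₁ f₂ : F₂hatT}
    (hf₁ : ∀ v ∈ V, f₁⁻¹ * (η v * twist (chi p v) f₁) = 1) (h₁B : f₁⁻¹ * Λ 1 ∈ bAxis)
    (hf₂ : ∀ v ∈ V, f₂⁻¹ * (η v * twist (chi p v) f₂) = 1) (h₂B : f₂⁻¹ * Λ 1 ∈ bAxis) :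
    f₁ = f₂ :=
  torusNormalForm_unique_of_permBasisFixedPoints p V permBasisFixedPoints_holds η Λ hf₁ h₁B hf₂ h₂B

end Literature.AnabelianGeometry.EtaleTheta.SettingModel.Slice1

end
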